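import Summits.QuantumFields.BalabanUV.Beta.D1BFx.NeedleNdlNdlPairings
import Summits.QuantumFields.BalabanUV.Beta.D1BFx.PairingByParts

/-!
# `BalabanUV.Beta.D1BFx.NeedleNdlDipRowLetters` — road «BF-x» for binder row D1, slot (K), END row `hGrp gN`, «GN-33 ∕ NK+KN» LETTERS (needle-row side):
# THE PAIRINGS OF THE NEEDLE POTENTIAL ROW `row_u` WITH THE DIPOLE PIECE's FOUR FUNCTIONS THROUGH THE GLUON LEG — `⟨∇row_u, Ga χ⟩` and `⟨Ga∇row_u, χ⟩`
# for a FLAT damped bond function `χ` (the projector rows `∇p_b`, `∇δp_b`) and for a COULOMB profile `χ` (`∇ρ_b`), and `⟨∇row_u, Ga∇f⟩` for a DIPOLE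
# VALUE profile `f` (`δρ_b`) — generic in the dip function, n-powers explicit, the needle weights `Σ_{s∈B(blk u)}|qJet_u s|·(profile at s − b)` KEPT

HONEST DEPENDENCY (cell records, verbatim): «continuum YM on T⁴ ⇐ BetaPertH ∧ nine spine estimates (0/9 proved); BetaPertH ⇐ (D1) ∧ (D4) ∧
CAP+tail; G-an2-4 gates asym, D1 and NE2/3/4.»  HONEST FRAMING (cell contract, verbatim): «discharging `BetaPertH` makes Bałaban's UV stability
UNCONDITIONAL — a real constructive-QFT result; it is NOT the continuum limit and NOT the Clay problem.»  THIS MODULE DISCHARGES NOTHING of the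
wall: [folklore] lattice bookkeeping over gan24-leaf-05-g42's generic letter forms `NeedleNdlNdlLetters.abs_pairing_needle_leg_flat_le` ∕
`abs_pairing_flat_leg_needle_le` ∕ `abs_pairing_needle_leg_needle_le`, `NeedleNdlNdlLetterForms` (`abs_grad_ndlRow_le`, the brackets `c1_le`∕`c2_le`∕`c3_le`∕`cg_le`),
leaf-04-g9's `PairingByParts.abs_applyK_grad_le_of_damped_profiles` and HLS kit `LatticeHLSDamped.abs_sum_mul_le_of_damped_profiles`,
`NeedleHLSGain.abs_pairing_le_of_needle_left`.  The leg enters ONLY through profile HYPOTHESES (`hA0`, `hA0'`, `hA1`, fed later by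
`NeedleDipDipLetters.exists_legLetters` modulo [B5, Prop. 1.2] ∧ [B5, (1.126)–(1.127)] BY NAME); the dip functions enter only through profile hypotheses
(fed by `NeedleDipDipLetters.exists_functionLetters`).  No `def`, no `def … : Prop`, nothing cited, 0 sorry.  Root-level binders hW ∕ hR-sockets ∕
hSX-socket ∕ D1Tel ∕ D1Rep — 0 discharged; (K) NOT closed; NOT D1, NOT `BetaPertH`, NOT continuum, NOT Clay.

ABSOLUTE RULE (cell charter, verbatim): «No internally-minted statement may enter as a cited fact. Every hypothesis is either kernel-proved in
this package or a verbatim quotation of a PUBLISHED theorem with page reference. The manuscript(s) under audit are NOT citable for their own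
disputed steps — they are the thing under adjudication; programme-internal (2001/route/tribunal) claims are never citable.»

WHY (owner d1-p2 gen 11 RULING ρ-g11-2, journal 2026-08-21T12:59Z: «GN-33 ∕ NK+KN → leaf-01 … word `bubble_dip_expand_right` + `bubble_ndl_dSw`
(sixteen pairing products …)»; my statement line l.31599).  By `NeedleDipShape.bubble_dip_expand_right` and `NeedleNdlShape.bubble_ndl_dSw` the
`ndl ⊗ dip` word at needle bond `(μ,u)`, dip bond `(ν,b)` is `Σ_{(f,g)} ±[S1(f)·S2(g) − S3(f)·S4(g)]` over `(f,g) ∈ {(δρ_b,p_b), (ρ_b,δp_b), (p_b,δρ_b),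
(δp_b,ρ_b)}` with `S1(f) = ⟨∇row_u, Ga∇f⟩`, `S4(g) = ⟨Ga∇row_u, ∇g⟩` (this file) and the column pairings `S2`, `S3` (`NeedleNdlDipColLetters`).  Every letter
here is `Σ_{s∈B(blk u)} |qJet_u s|·(…)(s − b)` so that the bond marginal M7 pays the census AFTER the w-sum (as in NP ∕ T₂-Q̇).  COUNT at rate `ε = δ∕n`:
flat `χ` (`|χ| ≤ Bg·e^{−ε‖x−b‖}`): `K·Bg·n·Σ_s|q|·e^{−(δ∕4n)‖s−b‖}` (`∇p_b`: `Bg = cF∕n⁵` ⇒ n⁻⁴; `∇δp_b`: `cF∕n⁶` ⇒ n⁻⁵); Coulomb `χ`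
(`|χ| ≤ Bρ·e∕nrm(x−b)³`): `K·Bρ·n⁻¹·Σ_s|q|∕nrm(s−b)` (critical (3,1) power-for-log trade, `Bρ = kR∕n²` ⇒ n⁻³); dipole value `f` (`|f| ≤ Bδ·e∕nrm³`):
`K·Bδ·n⁻²·Σ_s|q|·e∕nrm(s−b)` (`Ga∇f` by parts inside the leg: (3,3) ↦ 2, then (3,2) ↦ 1; `Bδ = kR∕n²` ⇒ n⁻⁴).
* §1 [folklore] **`exists_row_leg_flat_bound`** (S1, flat), **`exists_leg_row_flat_bound`** (S4, flat).
* §2 [folklore] **`exists_row_leg_coul_bound`** (S1, Coulomb), **`exists_leg_row_coul_bound`** (S4, Coulomb).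
* §3 [folklore] **`exists_row_leg_dip_bound`** (S1, dipole value).
NOT HERE (honest): `S4(δρ)` (needs the difference moved onto `Ga∇row_u` by parts — `NeedleNdlDipByParts`), the column pairings, the word, the census.
Unit `b2b-balaban-beta-d1-formalise-leaf-01` (gen 15), D1 formalisation swarm LEAF PROVER 01; `LEAVES-BFx.md` row (N) «GN-33∕NK+KN» letters 1.
-/

noncomputable section

namespace Summit.QuantumFields.BalabanUV.Beta.D1BFx.NeedleNdlDipRowLetters

open Finset
open scoped BigOperators
open Literature.MathematicalPhysics.QuantumFieldTheory.Balaban1983to89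
open Literature.MathematicalPhysics.QuantumFieldTheory.Balaban1983to89.Beta
open B6QGQLower276 (X e blk B mem_B)
open ExpKernelCalculus (Site MKer)
open Beta.PoissonInterior (nrm nrm_pos nrm_neg supNorm_neg)
open DyadicShell (Pt)
open AffineAveraging (unitVec)
open Summit.QuantumFields.BalabanUV.Beta.D1BFx.GluonLeg (Ga)
open Summit.QuantumFields.BalabanUV.Beta.D1BFx.GhostStencil (qJet)
open Summit.QuantumFields.BalabanUV.Beta.D1BFx.NeedlePotentialLetters (ndlRow)
open Summit.QuantumFields.BalabanUV.Beta.D1BFx.RColumnBlockMass (dR dR_pos)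
open Summit.QuantumFields.BalabanUV.Beta.D1BFx.RColumnProfile (kP kV_nonneg_and)
open Summit.QuantumFields.BalabanUV.Beta.D1BFx.RankOneBubble (pairing applyK pairing_comm)
open Summit.QuantumFields.BalabanUV.Beta.D1BFx.RankOneBubbleJets (grad)
open Summit.QuantumFields.BalabanUV.Beta.D1BFx.LatticeHLSDamped (abs_sum_mul_le_of_damped_profiles)
open Summit.QuantumFields.BalabanUV.Beta.D1BFx.NeedleHLSGain (abs_pairing_le_of_needle_left)
open Summit.QuantumFields.BalabanUV.Beta.D1BFx.PairingByParts (abs_applyK_grad_le_of_damped_profiles)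
open Summit.QuantumFields.BalabanUV.Beta.D1BFx.NeedleNdlNdlLetters (abs_pairing_needle_leg_needle_le abs_pairing_needle_leg_flat_le
  abs_pairing_flat_leg_needle_le)
open Summit.QuantumFields.BalabanUV.Beta.D1BFx.NeedleNdlNdlLetterForms (c2_le c3_le c1_le cg_le abs_grad_ndlRow_le)
open Summit.QuantumFields.BalabanUV.Beta.D1BFx.NeedleNdlNdlPairings (rate_le)

variable {a : ℝ}

/-- [folklore] rate weakening of a site damping: `e^{−(δ∕n)t} ≤ e^{−(δ∕4∕n)t}` and `e^{−(δ∕n∕2)t} ≤ e^{−(δ∕4∕n)t}`, `e^{−(δ∕n∕2∕2)t} = e^{−(δ∕4∕n)t}`. -/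
theorem exp_rate_quarter {δ : ℝ} (hδ : 0 ≤ δ) {n : ℕ} (hn : (0 : ℝ) < n) (t : ℕ) :
    Real.exp (-(δ / n) * t) ≤ Real.exp (-(δ / 4 / n) * t) ∧ Real.exp (-(δ / n / 2) * t) ≤ Real.exp (-(δ / 4 / n) * t)
      ∧ Real.exp (-(δ / n / 2 / 2) * t) = Real.exp (-(δ / 4 / n) * t) := by
  have ht : (0 : ℝ) ≤ t := Nat.cast_nonneg _
  have hdn : 0 ≤ δ / n * t := by positivity
  refine ⟨Real.exp_le_exp.2 ?_, Real.exp_le_exp.2 ?_, ?_⟩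
  · have : δ / 4 / n * t = (δ / n * t) / 4 := by ring
    rw [neg_mul, neg_mul, neg_le_neg_iff, this]; linarith
  · have : δ / 4 / n * t = (δ / n * t) / 4 := by ring
    have h2 : δ / n / 2 * t = (δ / n * t) / 2 := by ring
    rw [neg_mul, neg_mul, neg_le_neg_iff, this, h2]; linarith
  · congr 1; ring

/-! ## §1 Flat bond functions against the needle row (the projector rows `∇p_b`, `∇δp_b`) -/

section Flat

/-- [folklore] **S1, FLAT: `|⟨∇row_u, Ga χ⟩| ≤ K·Bg·n·Σ_{s∈B(blk u)} |qJet_u s|·e^{−(δ∕4n)‖s−b‖}`** for every flat damped `|χ x c| ≤ Bg·e^{−(δ∕n)‖x−b‖}`,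
every leg with the damped Coulomb entry profile `kA·e^{−(δ∕n)‖x−y‖}∕nrm(x−y)²`, `0 < δ ≤ dR a∕2`; `K` depends on `δ`, `kA`, `a` only
(`abs_pairing_needle_leg_flat_le`: needle outside (3, `kP∕n²`) × leg (2) × flat; brackets `c2 ≤ c₂'n²`, `c3 ≤ c₃'n`). -/
theorem exists_row_leg_flat_bound (ha : 0 < a) {δ kA : ℝ} (hδ0 : 0 < δ) (hδR : δ ≤ dR a / 2) (hkA : 0 ≤ kA) :
    ∃ K : ℝ, 0 ≤ K ∧ ∀ (n : ℕ) [NeZero n],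
      (∀ (x y : Site 4) (c e : Fin 4), |Ga n a x y c e| ≤ kA * Real.exp (-(δ / n) * Beta.PoissonInterior.supNorm (x - y)) / nrm (x - y) ^ 2) →
      ∀ (Bg : ℝ), 0 ≤ Bg → ∀ (b : Site 4) (χ : Site 4 → Fin 4 → ℝ),
        (∀ (x : Site 4) (c : Fin 4), |χ x c| ≤ Bg * Real.exp (-(δ / n) * Beta.PoissonInterior.supNorm (x - b))) →
        ∀ (κ : Fin 4) (u : Site 4),
          |pairing (grad (ndlRow n a κ u)) (applyK (Ga n a) χ)|
            ≤ K * Bg * n * ∑ s ∈ B (n - 1) (blk (n - 1) u), |qJet n κ u (blk (n - 1) u) s| *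
                Real.exp (-(δ / 4 / n) * Beta.PoissonInterior.supNorm (s - b)) := by
  have hkP := (kV_nonneg_and ha).2
  set c2' : ℝ := 1 + 2 * 4 * 3 ^ (4 - 1) * (4 / δ * (1 + 4 / δ)) with hc2'
  set c3' : ℝ := 1 + 2 * 4 * 3 ^ (4 - 1) * (1 + 8 / δ) with hc3'
  refine ⟨4 * (4 * kA * kP a * c2' * c3'), by positivity, fun n _ hA Bg hBg b χ hχ κ u => ?_⟩
  have hn : (0 : ℝ) < n := by exact_mod_cast Nat.pos_of_ne_zero (NeZero.ne n)
  have hn1 : 1 ≤ n := NeZero.one_le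
  set ε := δ / n with hε
  have hε0 : 0 < ε := div_pos hδ0 hn
  have hεR : ε ≤ dR a / 2 / n := by rw [hε]; exact rate_le hδR hn
  have hψ := fun x c => abs_grad_ndlRow_le n ha hεR κ u x c
  have h := abs_pairing_needle_leg_flat_le (F := Fin 4) (A := Ga n a) (B (n - 1) (blk (n - 1) u)) (fun s _ => abs_nonneg _)
    hkA (by positivity : 0 ≤ kP a / (n : ℝ) ^ 2) hBg hε0 (fun s => s) b hA hψ hχ
  refine h.trans ?_
  have hc2 : 1 + 2 * 4 * 3 ^ (4 - 1) * ((4 - 1 - 2).factorial * (2 / (ε / 2)) ^ (4 - 1 - 2) * (1 + 2 / (ε / 2))) ≤ c2' * (n : ℝ) ^ 2 :=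
    c2_le hδ0 hn1
  have hc3 : 1 + 2 * 4 * 3 ^ (4 - 1) * ((4 - 1 - 3).factorial * (2 / (ε / 2 / 2)) ^ (4 - 1 - 3) * (1 + 2 / (ε / 2 / 2))) ≤ c3' * (n : ℝ) ^ 1 :=
    c3_le hδ0 hn1
  have hcard : (Fintype.card (Fin 4) : ℝ) = 4 := by simp
  rw [hcard]
  have hpre : (4 : ℝ) * (4 * kA * Bg * (kP a / (n : ℝ) ^ 2) *
      (1 + 2 * 4 * 3 ^ (4 - 1) * ((4 - 1 - 2).factorial * (2 / (ε / 2)) ^ (4 - 1 - 2) * (1 + 2 / (ε / 2)))) *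
      (1 + 2 * 4 * 3 ^ (4 - 1) * ((4 - 1 - 3).factorial * (2 / (ε / 2 / 2)) ^ (4 - 1 - 3) * (1 + 2 / (ε / 2 / 2)))))
      ≤ 4 * (4 * kA * kP a * c2' * c3') * Bg * n := by
    calc (4 : ℝ) * (4 * kA * Bg * (kP a / (n : ℝ) ^ 2) *
          (1 + 2 * 4 * 3 ^ (4 - 1) * ((4 - 1 - 2).factorial * (2 / (ε / 2)) ^ (4 - 1 - 2) * (1 + 2 / (ε / 2)))) *
          (1 + 2 * 4 * 3 ^ (4 - 1) * ((4 - 1 - 3).factorial * (2 / (ε / 2 / 2)) ^ (4 - 1 - 3) * (1 + 2 / (ε / 2 / 2)))))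
        ≤ 4 * (4 * kA * Bg * (kP a / (n : ℝ) ^ 2) * (c2' * (n : ℝ) ^ 2) * (c3' * (n : ℝ) ^ 1)) := by gcongr
      _ = 4 * (4 * kA * kP a * c2' * c3') * Bg * n := by field_simp
  have hsum : ∑ s ∈ B (n - 1) (blk (n - 1) u), |qJet n κ u (blk (n - 1) u) s| * Real.exp (-(ε / 2 / 2) * Beta.PoissonInterior.supNorm (s - b))
      = ∑ s ∈ B (n - 1) (blk (n - 1) u), |qJet n κ u (blk (n - 1) u) s| * Real.exp (-(δ / 4 / n) * Beta.PoissonInterior.supNorm (s - b)) :=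
    Finset.sum_congr rfl fun s _ => by rw [hε, (exp_rate_quarter hδ0.le hn _).2.2]
  rw [hsum]
  exact mul_le_mul_of_nonneg_right hpre (Finset.sum_nonneg fun s _ => by positivity)

/-- [folklore] **S4, FLAT: `|⟨Ga∇row_u, χ⟩| ≤ K·Bg·n·Σ_{s∈B(blk u)} |qJet_u s|·e^{−(δ∕4n)‖s−b‖}`** (`pairing_comm`, then `abs_pairing_flat_leg_needle_le`: flat outside,
leg (2) × needle (3) inside ↦ needle-weighted exponent-1 profile, `c1 ≤ c₁'n³`; the rate `δ∕2n` weakened to `δ∕4n`). -/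
theorem exists_leg_row_flat_bound (ha : 0 < a) {δ kA : ℝ} (hδ0 : 0 < δ) (hδR : δ ≤ dR a / 2) (hkA : 0 ≤ kA) :
    ∃ K : ℝ, 0 ≤ K ∧ ∀ (n : ℕ) [NeZero n],
      (∀ (x y : Site 4) (c e : Fin 4), |Ga n a x y c e| ≤ kA * Real.exp (-(δ / n) * Beta.PoissonInterior.supNorm (x - y)) / nrm (x - y) ^ 2) →
      ∀ (Bg : ℝ), 0 ≤ Bg → ∀ (b : Site 4) (χ : Site 4 → Fin 4 → ℝ),
        (∀ (x : Site 4) (c : Fin 4), |χ x c| ≤ Bg * Real.exp (-(δ / n) * Beta.PoissonInterior.supNorm (x - b))) →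
        ∀ (κ : Fin 4) (u : Site 4),
          |pairing (applyK (Ga n a) (grad (ndlRow n a κ u))) χ|
            ≤ K * Bg * n * ∑ s ∈ B (n - 1) (blk (n - 1) u), |qJet n κ u (blk (n - 1) u) s| *
                Real.exp (-(δ / 4 / n) * Beta.PoissonInterior.supNorm (s - b)) := by
  have hkP := (kV_nonneg_and ha).2
  set C₄ : ℝ := 4 * 2 ^ (4 + 3) * 9 ^ (4 - 1) with hC₄
  set c1' : ℝ := 1 + 2 * 4 * 3 ^ (4 - 1) * (2 * (4 / δ) ^ 2 * (1 + 4 / δ)) with hc1'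
  refine ⟨4 * (4 * kA * kP a * C₄ * c1'), by positivity, fun n _ hA Bg hBg b χ hχ κ u => ?_⟩
  have hn : (0 : ℝ) < n := by exact_mod_cast Nat.pos_of_ne_zero (NeZero.ne n)
  have hn1 : 1 ≤ n := NeZero.one_le
  set ε := δ / n with hε
  have hε0 : 0 < ε := div_pos hδ0 hn
  have hεR : ε ≤ dR a / 2 / n := by rw [hε]; exact rate_le hδR hn
  have hφ := fun x c => abs_grad_ndlRow_le n ha hεR κ u x c
  rw [pairing_comm]
  have h := abs_pairing_flat_leg_needle_le (F := Fin 4) (A := Ga n a) (B (n - 1) (blk (n - 1) u)) (fun s _ => abs_nonneg _)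
    hkA (by positivity : 0 ≤ kP a / (n : ℝ) ^ 2) hBg hε0 (fun s => s) b hA hχ hφ
  refine h.trans ?_
  have hc1 : 1 + 2 * 4 * 3 ^ (4 - 1) * ((4 - 1 - 1).factorial * (2 / (ε / 2)) ^ (4 - 1 - 1) * (1 + 2 / (ε / 2))) ≤ c1' * (n : ℝ) ^ 3 :=
    c1_le hδ0 hn1
  have hcard : (Fintype.card (Fin 4) : ℝ) = 4 := by simp
  rw [hcard]
  have hpre : (4 : ℝ) * (4 * kA * (kP a / (n : ℝ) ^ 2) * (4 * 2 ^ (4 + 3) * 9 ^ (4 - 1)) * Bg *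
      (1 + 2 * 4 * 3 ^ (4 - 1) * ((4 - 1 - 1).factorial * (2 / (ε / 2)) ^ (4 - 1 - 1) * (1 + 2 / (ε / 2)))))
      ≤ 4 * (4 * kA * kP a * C₄ * c1') * Bg * n := by
    calc (4 : ℝ) * (4 * kA * (kP a / (n : ℝ) ^ 2) * (4 * 2 ^ (4 + 3) * 9 ^ (4 - 1)) * Bg *
          (1 + 2 * 4 * 3 ^ (4 - 1) * ((4 - 1 - 1).factorial * (2 / (ε / 2)) ^ (4 - 1 - 1) * (1 + 2 / (ε / 2)))))
        ≤ 4 * (4 * kA * (kP a / (n : ℝ) ^ 2) * (4 * 2 ^ (4 + 3) * 9 ^ (4 - 1)) * Bg * (c1' * (n : ℝ) ^ 3)) := by gcongr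
      _ = 4 * (4 * kA * kP a * C₄ * c1') * Bg * n := by rw [hC₄]; field_simp
  have hsum : ∑ s ∈ B (n - 1) (blk (n - 1) u), |qJet n κ u (blk (n - 1) u) s| * Real.exp (-(ε / 2) * Beta.PoissonInterior.supNorm (s - b))
      ≤ ∑ s ∈ B (n - 1) (blk (n - 1) u), |qJet n κ u (blk (n - 1) u) s| * Real.exp (-(δ / 4 / n) * Beta.PoissonInterior.supNorm (s - b)) :=
    Finset.sum_le_sum fun s _ => mul_le_mul_of_nonneg_left (by rw [hε]; exact (exp_rate_quarter hδ0.le hn _).2.1) (abs_nonneg _)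
  exact mul_le_mul hpre hsum (Finset.sum_nonneg fun s _ => by positivity) (by positivity)

end Flat

/-! ## §2 A Coulomb profile at the dip bond against the needle row (`∇ρ_b`): the critical pair (3,1), power-for-log -/

section Coulomb

/-- [folklore] **S1, COULOMB: `|⟨∇row_u, Ga χ⟩| ≤ K·Bρ·n⁻¹·Σ_{s∈B(blk u)} |qJet_u s|∕nrm(s−b)`** for `|χ x c| ≤ Bρ·e^{−(δ∕n)‖x−b‖}∕nrm(x−b)³`
(`abs_pairing_needle_leg_needle_le` with the one-site needle `{b}` inside: leg × cubic ↦ exponent 1, then the critical (3,1) sum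
`NeedleHLSGain.sum_exp_div_nrm_pow_mul_nrm_le` — the gain `1∕nrm(s−b)` at the price `cg ≤ c_g'·n`). -/
theorem exists_row_leg_coul_bound (ha : 0 < a) {δ kA : ℝ} (hδ0 : 0 < δ) (hδR : δ ≤ dR a / 2) (hkA : 0 ≤ kA) :
    ∃ K : ℝ, 0 ≤ K ∧ ∀ (n : ℕ) [NeZero n],
      (∀ (x y : Site 4) (c e : Fin 4), |Ga n a x y c e| ≤ kA * Real.exp (-(δ / n) * Beta.PoissonInterior.supNorm (x - y)) / nrm (x - y) ^ 2) →
      ∀ (Bρ : ℝ), 0 ≤ Bρ → ∀ (b : Site 4) (χ : Site 4 → Fin 4 → ℝ),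
        (∀ (x : Site 4) (c : Fin 4), |χ x c| ≤ Bρ * Real.exp (-(δ / n) * Beta.PoissonInterior.supNorm (x - b)) / nrm (x - b) ^ 3) →
        ∀ (κ : Fin 4) (u : Site 4),
          |pairing (grad (ndlRow n a κ u)) (applyK (Ga n a) χ)|
            ≤ K * Bρ * ((n : ℝ) ^ 1)⁻¹ * ∑ s ∈ B (n - 1) (blk (n - 1) u), |qJet n κ u (blk (n - 1) u) s| / nrm (s - b) := by
  have hkP := (kV_nonneg_and ha).2
  set C₄ : ℝ := 4 * 2 ^ (4 + 3) * 9 ^ (4 - 1) with hC₄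
  set cg' : ℝ := (1 + 2 * 4 * 3 ^ (4 - 1)) * (2 + 3 ^ (4 - 1)) * (1 + 2 / δ) with hcg'
  refine ⟨4 * (4 * kA * kP a * C₄ * cg'), by positivity, fun n _ hA Bρ hBρ b χ hχ κ u => ?_⟩
  have hn : (0 : ℝ) < n := by exact_mod_cast Nat.pos_of_ne_zero (NeZero.ne n)
  have hn1 : 1 ≤ n := NeZero.one_le
  set ε := δ / n with hε
  have hε0 : 0 < ε := div_pos hδ0 hn
  have hεR : ε ≤ dR a / 2 / n := by rw [hε]; exact rate_le hδR hn
  have hψ := fun x c => abs_grad_ndlRow_le n ha hεR κ u x c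
  -- the Coulomb profile as a one-site needle
  have hχ' : ∀ (x : Site 4) (c : Fin 4), |χ x c| ≤ ∑ s' ∈ (Finset.univ : Finset Unit), (1 : ℝ) *
      (Bρ * Real.exp (-ε * Beta.PoissonInterior.supNorm (x - (fun _ : Unit => b) s')) / nrm (x - (fun _ : Unit => b) s') ^ 3) := fun x c => by
    simpa [hε] using hχ x c
  have h := abs_pairing_needle_leg_needle_le (F := Fin 4) (A := Ga n a) (B (n - 1) (blk (n - 1) u)) (Finset.univ : Finset Unit)
    (q' := fun _ => (1 : ℝ)) (fun s _ => abs_nonneg _) (fun _ _ => zero_le_one) hkA (by positivity : 0 ≤ kP a / (n : ℝ) ^ 2) hBρ hε0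
    (fun s => s) (fun _ => b) hA hψ hχ'
  refine h.trans ?_
  have hcg : (1 + 2 * 4 * 3 ^ (4 - 1)) * (2 + 3 ^ (4 - 1)) * (1 + 2 / ε) ≤ cg' * (n : ℝ) ^ 1 := by rw [hε]; exact cg_le hδ0 hn1
  have hcard : (Fintype.card (Fin 4) : ℝ) = 4 := by simp
  rw [hcard]
  have hS : ∑ s ∈ B (n - 1) (blk (n - 1) u), ∑ s' ∈ (Finset.univ : Finset Unit), |qJet n κ u (blk (n - 1) u) s| * 1 / nrm (s - b)
      = ∑ s ∈ B (n - 1) (blk (n - 1) u), |qJet n κ u (blk (n - 1) u) s| / nrm (s - b) := Finset.sum_congr rfl fun s _ => by simp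
  rw [hS]
  have hW0 : 0 ≤ ∑ s ∈ B (n - 1) (blk (n - 1) u), |qJet n κ u (blk (n - 1) u) s| / nrm (s - b) :=
    Finset.sum_nonneg fun s _ => by have := nrm_pos (s - b); positivity
  have hpre : (4 : ℝ) * (4 * kA * (kP a / (n : ℝ) ^ 2) * Bρ * (4 * 2 ^ (4 + 3) * 9 ^ (4 - 1)) *
      ((1 + 2 * 4 * 3 ^ (4 - 1)) * (2 + 3 ^ (4 - 1)) * (1 + 2 / ε))) ≤ 4 * (4 * kA * kP a * C₄ * cg') * Bρ * ((n : ℝ) ^ 1)⁻¹ := by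
    calc (4 : ℝ) * (4 * kA * (kP a / (n : ℝ) ^ 2) * Bρ * (4 * 2 ^ (4 + 3) * 9 ^ (4 - 1)) *
          ((1 + 2 * 4 * 3 ^ (4 - 1)) * (2 + 3 ^ (4 - 1)) * (1 + 2 / ε)))
        ≤ 4 * (4 * kA * (kP a / (n : ℝ) ^ 2) * Bρ * (4 * 2 ^ (4 + 3) * 9 ^ (4 - 1)) * (cg' * (n : ℝ) ^ 1)) := by gcongr
      _ = 4 * (4 * kA * kP a * C₄ * cg') * Bρ * ((n : ℝ) ^ 1)⁻¹ := by rw [hC₄]; field_simp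
  exact mul_le_mul_of_nonneg_right hpre hW0

/-- [folklore] **S4, COULOMB: `|⟨Ga∇row_u, χ⟩| ≤ K·Bρ·n⁻¹·Σ_{s∈B(blk u)} |qJet_u s|∕nrm(s−b)`** (`pairing_comm`; the one-site needle `{b}` OUTSIDE, the needle
row inside; `nrm(b − s) = nrm(s − b)`). -/
theorem exists_leg_row_coul_bound (ha : 0 < a) {δ kA : ℝ} (hδ0 : 0 < δ) (hδR : δ ≤ dR a / 2) (hkA : 0 ≤ kA) :
    ∃ K : ℝ, 0 ≤ K ∧ ∀ (n : ℕ) [NeZero n],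
      (∀ (x y : Site 4) (c e : Fin 4), |Ga n a x y c e| ≤ kA * Real.exp (-(δ / n) * Beta.PoissonInterior.supNorm (x - y)) / nrm (x - y) ^ 2) →
      ∀ (Bρ : ℝ), 0 ≤ Bρ → ∀ (b : Site 4) (χ : Site 4 → Fin 4 → ℝ),
        (∀ (x : Site 4) (c : Fin 4), |χ x c| ≤ Bρ * Real.exp (-(δ / n) * Beta.PoissonInterior.supNorm (x - b)) / nrm (x - b) ^ 3) →
        ∀ (κ : Fin 4) (u : Site 4),
          |pairing (applyK (Ga n a) (grad (ndlRow n a κ u))) χ|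
            ≤ K * Bρ * ((n : ℝ) ^ 1)⁻¹ * ∑ s ∈ B (n - 1) (blk (n - 1) u), |qJet n κ u (blk (n - 1) u) s| / nrm (s - b) := by
  have hkP := (kV_nonneg_and ha).2
  set C₄ : ℝ := 4 * 2 ^ (4 + 3) * 9 ^ (4 - 1) with hC₄
  set cg' : ℝ := (1 + 2 * 4 * 3 ^ (4 - 1)) * (2 + 3 ^ (4 - 1)) * (1 + 2 / δ) with hcg'
  refine ⟨4 * (4 * kA * kP a * C₄ * cg'), by positivity, fun n _ hA Bρ hBρ b χ hχ κ u => ?_⟩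
  have hn : (0 : ℝ) < n := by exact_mod_cast Nat.pos_of_ne_zero (NeZero.ne n)
  have hn1 : 1 ≤ n := NeZero.one_le
  set ε := δ / n with hε
  have hε0 : 0 < ε := div_pos hδ0 hn
  have hεR : ε ≤ dR a / 2 / n := by rw [hε]; exact rate_le hδR hn
  have hφ := fun x c => abs_grad_ndlRow_le n ha hεR κ u x c
  have hχ' : ∀ (x : Site 4) (c : Fin 4), |χ x c| ≤ ∑ s' ∈ (Finset.univ : Finset Unit), (1 : ℝ) *
      (Bρ * Real.exp (-ε * Beta.PoissonInterior.supNorm (x - (fun _ : Unit => b) s')) / nrm (x - (fun _ : Unit => b) s') ^ 3) := fun x c => by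
    simpa [hε] using hχ x c
  rw [pairing_comm]
  have h := abs_pairing_needle_leg_needle_le (F := Fin 4) (A := Ga n a) (Finset.univ : Finset Unit) (B (n - 1) (blk (n - 1) u))
    (q := fun _ => (1 : ℝ)) (fun _ _ => zero_le_one) (fun s _ => abs_nonneg _) hkA hBρ (by positivity : 0 ≤ kP a / (n : ℝ) ^ 2) hε0
    (fun _ => b) (fun s => s) hA hχ' hφ
  refine h.trans ?_
  have hcg : (1 + 2 * 4 * 3 ^ (4 - 1)) * (2 + 3 ^ (4 - 1)) * (1 + 2 / ε) ≤ cg' * (n : ℝ) ^ 1 := by rw [hε]; exact cg_le hδ0 hn1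
  have hcard : (Fintype.card (Fin 4) : ℝ) = 4 := by simp
  rw [hcard]
  have hS : ∑ s' ∈ (Finset.univ : Finset Unit), ∑ s ∈ B (n - 1) (blk (n - 1) u), 1 * |qJet n κ u (blk (n - 1) u) s| / nrm (b - s)
      = ∑ s ∈ B (n - 1) (blk (n - 1) u), |qJet n κ u (blk (n - 1) u) s| / nrm (s - b) := by
    rw [Finset.sum_const, Finset.card_univ, Fintype.card_unit, one_smul]
    exact Finset.sum_congr rfl fun s _ => by rw [one_mul, ← neg_sub s b, nrm_neg]
  rw [hS]
  have hW0 : 0 ≤ ∑ s ∈ B (n - 1) (blk (n - 1) u), |qJet n κ u (blk (n - 1) u) s| / nrm (s - b) :=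
    Finset.sum_nonneg fun s _ => by have := nrm_pos (s - b); positivity
  have hpre : (4 : ℝ) * (4 * kA * Bρ * (kP a / (n : ℝ) ^ 2) * (4 * 2 ^ (4 + 3) * 9 ^ (4 - 1)) *
      ((1 + 2 * 4 * 3 ^ (4 - 1)) * (2 + 3 ^ (4 - 1)) * (1 + 2 / ε))) ≤ 4 * (4 * kA * kP a * C₄ * cg') * Bρ * ((n : ℝ) ^ 1)⁻¹ := by
    calc (4 : ℝ) * (4 * kA * Bρ * (kP a / (n : ℝ) ^ 2) * (4 * 2 ^ (4 + 3) * 9 ^ (4 - 1)) *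
          ((1 + 2 * 4 * 3 ^ (4 - 1)) * (2 + 3 ^ (4 - 1)) * (1 + 2 / ε)))
        ≤ 4 * (4 * kA * Bρ * (kP a / (n : ℝ) ^ 2) * (4 * 2 ^ (4 + 3) * 9 ^ (4 - 1)) * (cg' * (n : ℝ) ^ 1)) := by gcongr
      _ = 4 * (4 * kA * kP a * C₄ * cg') * Bρ * ((n : ℝ) ^ 1)⁻¹ := by rw [hC₄]; field_simp
  exact mul_le_mul_of_nonneg_right hpre hW0

end Coulomb

/-! ## §3 The dipole value profile at the dip bond against the needle row (`δρ_b`): the leg's by-parts gain -/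

section Dipole

/-- [folklore] **S1, DIPOLE: `|⟨∇row_u, Ga∇f⟩| ≤ K·Bδ·n⁻²·Σ_{s∈B(blk u)} |qJet_u s|·e^{−(δ∕4n)‖s−b‖}∕nrm(s−b)`** for a dipole value profile
`|f x| ≤ Bδ·e^{−(δ∕n)‖x−b‖}∕nrm(x−b)³` and a leg with entry ∕ shifted-entry ∕ backward second-site d1 letters `kA`, `kA'`, `kA₁` at rate `δ∕n`
(`PairingByParts.abs_applyK_grad_le_of_damped_profiles`: `|Ga∇f| ≤ 4kA₁BδC₄·e∕nrm(x−b)²`; then per needle site the non-critical damped pair (3,2) ↦ 1,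
`abs_sum_mul_le_of_damped_profiles`, an n-free constant; the rate `δ∕n` weakened to `δ∕4n`). -/
theorem exists_row_leg_dip_bound (ha : 0 < a) {δ kA kA' kA₁ : ℝ} (hδ0 : 0 < δ) (hδR : δ ≤ dR a / 2) (hkA : 0 ≤ kA) (hkA' : 0 ≤ kA')
    (hkA₁ : 0 ≤ kA₁) :
    ∃ K : ℝ, 0 ≤ K ∧ ∀ (n : ℕ) [NeZero n],
      (∀ (x y : Site 4) (c e : Fin 4), |Ga n a x y c e| ≤ kA * Real.exp (-(δ / n) * Beta.PoissonInterior.supNorm (x - y)) / nrm (x - y) ^ 2) →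
      (∀ (x y : Site 4) (c e : Fin 4), |Ga n a x (y - unitVec e) c e| ≤ kA' * Real.exp (-(δ / n) * Beta.PoissonInterior.supNorm (x - y)) / nrm (x - y) ^ 2) →
      (∀ (x y : Site 4) (c e : Fin 4), |Ga n a x (y - unitVec e) c e - Ga n a x y c e|
          ≤ kA₁ * Real.exp (-(δ / n) * Beta.PoissonInterior.supNorm (x - y)) / nrm (x - y) ^ 3) →
      ∀ (Bδ : ℝ), 0 ≤ Bδ → ∀ (b : Site 4) (f : Site 4 → ℝ),
        (∀ x : Site 4, |f x| ≤ Bδ * Real.exp (-(δ / n) * Beta.PoissonInterior.supNorm (x - b)) / nrm (x - b) ^ 3) →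
        ∀ (κ : Fin 4) (u : Site 4),
          |pairing (grad (ndlRow n a κ u)) (applyK (Ga n a) (grad f))|
            ≤ K * Bδ * ((n : ℝ) ^ 2)⁻¹ * ∑ s ∈ B (n - 1) (blk (n - 1) u), |qJet n κ u (blk (n - 1) u) s| *
                (Real.exp (-(δ / 4 / n) * Beta.PoissonInterior.supNorm (s - b)) / nrm (s - b)) := by
  have hkP := (kV_nonneg_and ha).2
  set C₄ : ℝ := 4 * 2 ^ (4 + 3) * 9 ^ (4 - 1) with hC₄
  refine ⟨4 * (kP a * (4 * kA₁ * C₄) * C₄), by positivity, fun n _ hA0 hA0' hA1 Bδ hBδ b f hf κ u => ?_⟩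
  have hn : (0 : ℝ) < n := by exact_mod_cast Nat.pos_of_ne_zero (NeZero.ne n)
  set ε := δ / n with hε
  have hε0 : 0 < ε := div_pos hδ0 hn
  have hεR : ε ≤ dR a / 2 / n := by rw [hε]; exact rate_le hδR hn
  have hψ := fun x c => abs_grad_ndlRow_le n ha hεR κ u x c
  -- the dipole end by parts inside the leg: (3,3) ↦ 2
  have hχ : ∀ (x : Site 4) (c : Fin 4), |applyK (Ga n a) (grad f) x c|
      ≤ 4 * kA₁ * Bδ * C₄ * Real.exp (-ε * Beta.PoissonInterior.supNorm (x - b)) / nrm (x - b) ^ 2 := fun x c => by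
    have h := abs_applyK_grad_le_of_damped_profiles hkA hkA' hkA₁ hBδ hε0.le b hA0 hA0' hA1 hf x c
    rw [hC₄]; exact h
  have h := abs_pairing_le_of_needle_left (F := Fin 4) (B (n - 1) (blk (n - 1) u)) (fun s _ => abs_nonneg _)
    (g := fun s x => kP a / (n : ℝ) ^ 2 * Real.exp (-ε * Beta.PoissonInterior.supNorm (x - s)) / nrm (x - s) ^ 3)
    (h := fun x => 4 * kA₁ * Bδ * C₄ * Real.exp (-ε * Beta.PoissonInterior.supNorm (x - b)) / nrm (x - b) ^ 2)
    (G := fun s => kP a / (n : ℝ) ^ 2 * (4 * kA₁ * Bδ * C₄) * C₄ * Real.exp (-ε * Beta.PoissonInterior.supNorm (s - b)) / nrm (s - b) ^ 1)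
    hψ hχ ?_
  · refine h.2.trans ?_
    have hcard : (Fintype.card (Fin 4) : ℝ) = 4 := by simp
    rw [hcard, Finset.mul_sum, Finset.mul_sum]
    refine Finset.sum_le_sum fun s _ => ?_
    have hns := nrm_pos (s - b)
    have hq := abs_nonneg (qJet n κ u (blk (n - 1) u) s)
    have hexp : Real.exp (-ε * Beta.PoissonInterior.supNorm (s - b)) ≤ Real.exp (-(δ / 4 / n) * Beta.PoissonInterior.supNorm (s - b)) := by
      rw [hε]; exact (exp_rate_quarter hδ0.le hn _).1
    rw [pow_one]
    calc (4 : ℝ) * (|qJet n κ u (blk (n - 1) u) s| * (kP a / (n : ℝ) ^ 2 * (4 * kA₁ * Bδ * C₄) * C₄ *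
          Real.exp (-ε * Beta.PoissonInterior.supNorm (s - b)) / nrm (s - b)))
        = 4 * (kP a * (4 * kA₁ * C₄) * C₄) * Bδ * ((n : ℝ) ^ 2)⁻¹ * (|qJet n κ u (blk (n - 1) u) s| *
            (Real.exp (-ε * Beta.PoissonInterior.supNorm (s - b)) / nrm (s - b))) := by field_simp
      _ ≤ 4 * (kP a * (4 * kA₁ * C₄) * C₄) * Bδ * ((n : ℝ) ^ 2)⁻¹ * (|qJet n κ u (blk (n - 1) u) s| *
            (Real.exp (-(δ / 4 / n) * Beta.PoissonInterior.supNorm (s - b)) / nrm (s - b))) :=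
          mul_le_mul_of_nonneg_left (mul_le_mul_of_nonneg_left (div_le_div_of_nonneg_right hexp hns.le) hq) (by positivity)
  · intro s _ S
    have h1 := abs_sum_mul_le_of_damped_profiles (d := 4) (by norm_num) (a := 3) (b := 2) (by norm_num) (by norm_num) (by norm_num)
      (by positivity : 0 ≤ kP a / (n : ℝ) ^ 2) (by positivity : 0 ≤ 4 * kA₁ * Bδ * C₄) hε0.le S s b
      (K := fun x => kP a / (n : ℝ) ^ 2 * Real.exp (-ε * Beta.PoissonInterior.supNorm (x - s)) / nrm (x - s) ^ 3)
      (f := fun x => 4 * kA₁ * Bδ * C₄ * Real.exp (-ε * Beta.PoissonInterior.supNorm (x - b)) / nrm (x - b) ^ 2)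
      (fun x _ => by rw [abs_of_nonneg (by have := nrm_pos (x - s); positivity)])
      (fun x _ => by rw [abs_of_nonneg (by have := nrm_pos (x - b); positivity)])
    refine le_trans (le_of_eq ?_) (h1.trans (le_of_eq ?_))
    · exact Finset.sum_congr rfl fun x _ => by
        rw [abs_of_nonneg (mul_nonneg (by have := nrm_pos (x - s); positivity) (by have := nrm_pos (x - b); positivity))]
    · rw [hC₄]; norm_num

end Dipole

end Summit.QuantumFields.BalabanUV.Beta.D1BFx.NeedleNdlDipRowLetters

end
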